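import Mathlib

/-!
# Step certificate (E1b v1-Tc, analytic core)

On one time step `[a, b]` the E1-lite certificate compares the exact solution `W` of the linear(ised)
system `W' = v t W` with a certified polynomial `P` that starts at the same value and has defect
`‖P' - v t P‖ ≤ ε` on the step.  Grönwall gives `‖W t - P t‖ ≤ ε (t - a) e^{K (t - a)}`, which is the
per-step term fed into the discrete Duhamel recursion (`SoloBlindDiscreteDuhamel`).  Thin wrapper of
`dist_le_of_approx_trajectories_ODE` (kernel #184).
-/

namespace Summit.AnomalousDissipation.AnomalousDissipation.Theorems

open Set Real NNReal

/-- `gronwallBound 0 K ε x ≤ ε x e^{K x}` for `0 ≤ ε`, `0 ≤ K` (all real `x`). -/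
theorem gronwallBound_zero_le {K ε : ℝ} (x : ℝ) (hK : 0 ≤ K) (hε : 0 ≤ ε) :
    gronwallBound 0 K ε x ≤ ε * x * Real.exp (K * x) := by
  rcases eq_or_lt_of_le hK with hK0 | hKpos
  · rw [← hK0, gronwallBound_K0]
    simp
  · rw [gronwallBound_of_K_ne_0 hKpos.ne']
    simp only [zero_mul, zero_add]
    -- folklore: `exp y - 1 ≤ y * exp y` (also landed as `AreaLaw.exp_sub_one_le_mul_exp` in the
    -- Literature QFT sweep; inlined here to keep this kernel's imports to Mathlib)
    have h : Real.exp (K * x) - 1 ≤ K * x * Real.exp (K * x) := by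
      have h1 : 1 - K * x ≤ Real.exp (-(K * x)) := by
        have := Real.add_one_le_exp (-(K * x)); linarith
      have h2 : (1 - K * x) * Real.exp (K * x) ≤ Real.exp (-(K * x)) * Real.exp (K * x) :=
        mul_le_mul_of_nonneg_right h1 (Real.exp_pos _).le
      rw [← Real.exp_add, neg_add_cancel, Real.exp_zero] at h2
      nlinarith [Real.exp_pos (K * x)]
    have : ε / K * (Real.exp (K * x) - 1) ≤ ε / K * (K * x * Real.exp (K * x)) :=
      mul_le_mul_of_nonneg_left h (div_nonneg hε hK)
    calc ε / K * (Real.exp (K * x) - 1) ≤ ε / K * (K * x * Real.exp (K * x)) := this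
      _ = ε * x * Real.exp (K * x) := by field_simp

variable {E : Type*} [NormedAddCommGroup E] [NormedSpace ℝ E]

/-- STEP CERTIFICATE.  `W` solves `W' = v t W` exactly on `[a, b)`, `P` is any `C¹` curve with the same
initial value and defect `dist (P' t) (v t (P t)) ≤ ε`; `v t` is `K`-Lipschitz.  Then
`dist (W t) (P t) ≤ gronwallBound 0 K ε (t - a)` on `[a, b]`. -/
theorem step_certificate_gronwall {v : ℝ → E → E} {K : ℝ≥0} {W P P' : ℝ → E} {a b ε : ℝ}
    (hv : ∀ t, LipschitzWith K (v t))
    (hW : ContinuousOn W (Icc a b))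
    (hW' : ∀ t ∈ Ico a b, HasDerivWithinAt W (v t (W t)) (Ici t) t)
    (hP : ContinuousOn P (Icc a b))
    (hP' : ∀ t ∈ Ico a b, HasDerivWithinAt P (P' t) (Ici t) t)
    (defect : ∀ t ∈ Ico a b, dist (P' t) (v t (P t)) ≤ ε)
    (h0 : W a = P a) :
    ∀ t ∈ Icc a b, dist (W t) (P t) ≤ gronwallBound 0 K ε (t - a) := by
  have hWb : ∀ t ∈ Ico a b, dist (v t (W t)) (v t (W t)) ≤ 0 := fun t _ => by simp
  have ha : dist (W a) (P a) ≤ 0 := by simp [h0]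
  have := dist_le_of_approx_trajectories_ODE (f' := fun t => v t (W t)) hv hW hW' hWb hP hP' defect ha
  simpa using this

/-- STEP CERTIFICATE, usable form: `dist (W t) (P t) ≤ ε (t - a) e^{K (t - a)}` on `[a, b]`
(for `0 ≤ ε`). -/
theorem step_certificate {v : ℝ → E → E} {K : ℝ≥0} {W P P' : ℝ → E} {a b ε : ℝ}
    (hv : ∀ t, LipschitzWith K (v t))
    (hW : ContinuousOn W (Icc a b))
    (hW' : ∀ t ∈ Ico a b, HasDerivWithinAt W (v t (W t)) (Ici t) t)
    (hP : ContinuousOn P (Icc a b))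
    (hP' : ∀ t ∈ Ico a b, HasDerivWithinAt P (P' t) (Ici t) t)
    (defect : ∀ t ∈ Ico a b, dist (P' t) (v t (P t)) ≤ ε) (hε : 0 ≤ ε)
    (h0 : W a = P a) :
    ∀ t ∈ Icc a b, dist (W t) (P t) ≤ ε * (t - a) * Real.exp (K * (t - a)) := by
  intro t ht
  have h := step_certificate_gronwall hv hW hW' hP hP' defect h0 t ht
  exact h.trans (gronwallBound_zero_le (t - a) K.2 hε)

end Summit.AnomalousDissipation.AnomalousDissipation.Theorems
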